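import Mathlib
import Summits.ResolutionOfSingularities.ResolutionOfSingularities.Theorems.HomologicalConductorPersistenceKC3Lower
import HarnessLib

/-!
# Crux `Persistence` (stmt-ResolutionOfSingularities-16484) / rung S-2 cA ARENA — part A of the fact-free ENABLING FORMULA
# lower half: bookkeeping for a general `h ∈ k[z,t]` and the MIDDLE STAGE `k[x,z,t]/(x² − h) ↠ k[z,t]/(h)`

Route `ResolutionOfSingularities/HomologicalConductor`, chain W4.4b (cell `res-hironaka`): crux `Persistence`
(stmt-ResolutionOfSingularities-16484, K-C3 family of kill sources) and rung S-2 `PersistenceSurface` (stmt-…-19970, the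
«cA ARENA» `T_h = {xy = h(z,t)}` of res-L1-w44b-plan-1's K-v13 (c), whose ENABLING FORMULA `ca(T_h) = (x,y) + ca(C_h)·T_h`
was admitted from print as THEOREM DP).  `[OURS · L1 w44b · res-L1-w44b-stub-2 gen 4]`; NOT a statement of the manuscript
under review (Hironaka 2017), no statement of that manuscript is used; AI-written, weaker than expert review.

## Statement of the pair of files (this = part A; `…PersistenceArenaLower` = part B, `mk_inclusion_mem_cohomologyAnnihilatorOfDegree_four`)

`k` a field with `2 ≠ 0`, `0 ≠ h ∈ k[z,t] = MvPolynomial (Fin 2) k`, `ι : k[z,t] → k[x,y,z,t]` (`z ↦ X 2`, `t ↦ X 3`),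
`T_h = k[x,y,z,t]/(xy − ι h)`, `C_h = k[z,t]/(h)`.  If `c̄ ∈ ca²(C_h)` then `(ι c)‾ ∈ ca⁴(T_h)`; also `x̄, ȳ ∈ ca⁴(T_h)`.
Hence `((x, y) + ι(ca²(C_h)))·T_h ≤ ca⁴(T_h) ≤ ca(T_h)` (`map_le_cohomologyAnnihilatorOfDegree_four`), and the same at every
localisation of `T_h`.  NO hypothesis on `h` beyond `h ≠ 0` (reduced / unibranch / isolated not needed); the curve-level
input `ca²(C_h)` is whatever one knows (conductor of a parametrised branch via `…PersistenceConductorStable`, Jacobian, …).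

## Proof (= the K-C3 tower of `…PersistenceKC3Lower` with `h` a variable)

`T_h ↠(y ↦ x) B_h = k[x,z,t]/(x² − h) ↠(x ↦ 0) C_h`, kernels `(x̄ − ȳ)` and `(x̄)`; `x̄ − ȳ ∈ T_h⁰ ∩ ca⁴(T_h)`
(`x = ∂f/∂y`, `y = ∂f/∂x`), `x̄ ∈ B_h⁰ ∩ ca³(B_h)` (`2x = ∂F′/∂x`); quotient ascent along surjections
(`KC3Lower.mem_cohomologyAnnihilatorOfDegree_of_surjective`, p535893, from `QuotientAscent` p531707) twice.

References (mechanism only): res-L1-w44b-plan-1 CHAIN w44b v13.3–13.9 (K-v13 (c) arena, THEOREM DP); Ö. Esentepe, J. Algebra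
541 (2020) Thm 5.4 (whose lower-bound half this proves for the xy-form, all characteristics ≠ 2) [`Esentepe2020`]; H. Knörrer,
Invent. Math. 88 (1987).
-/

noncomputable section

-- single-problem summit: the doubled namespace component `ResolutionOfSingularities` is forced
set_option linter.dupNamespace false

namespace Summit.ResolutionOfSingularities.ResolutionOfSingularities.Theorems.HomologicalConductor.ArenaLowerMiddle

open MvPolynomial Literature.RingTheory.CohomologyAnnihilator
open Summit.ResolutionOfSingularities.ResolutionOfSingularities.Theorems.HomologicalConductor.PersistenceJacobianKept
open Summit.ResolutionOfSingularities.ResolutionOfSingularities.Theorems.HomologicalConductor.QuotientAscent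
open Summit.ResolutionOfSingularities.ResolutionOfSingularities.Theorems.HomologicalConductor.KC3Lower
open scoped nonZeroDivisors

universe u

variable (k : Type u) [Field k]

/-! ## §1 Substitution bookkeeping for a general `h ∈ k[z,t]` -/

/-- A partial derivative kills every polynomial substituted from variables it does not see: if `∂ⱼ (g i) = 0` for all `i`
then `∂ⱼ (p(g)) = 0`. [folklore] -/
theorem pderiv_aeval_eq_zero {σ τ : Type*} (g : σ → MvPolynomial τ k) (j : τ)
    (hg : ∀ i, MvPolynomial.pderiv j (g i) = 0) (p : MvPolynomial σ k) :
    MvPolynomial.pderiv j (MvPolynomial.aeval g p) = 0 := by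
  induction p using MvPolynomial.induction_on with
  | C a => simp
  | add p q hp hq => rw [map_add, map_add, hp, hq, add_zero]
  | mul_X p i hp => rw [map_mul, MvPolynomial.aeval_X, Derivation.leibniz, hp, hg i, smul_zero, smul_zero, add_zero]

/-- `∂ₓ (ι′ h) = 0` for `ι′ : z ↦ X 1, t ↦ X 2` into `k[x,z,t]`. [folklore] -/
theorem pderiv_zero_inclusion₃ (h : MvPolynomial (Fin 2) k) :
    MvPolynomial.pderiv 0 ((MvPolynomial.aeval (![X 1, X 2] : Fin 2 → MvPolynomial (Fin 3) k)) h) = 0 :=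
  pderiv_aeval_eq_zero k _ 0 (fun i => by fin_cases i <;> simp [MvPolynomial.pderiv_X]) h

/-- `∂ₓ (ι h) = 0` for `ι : z ↦ X 2, t ↦ X 3` into `k[x,y,z,t]`. [folklore] -/
theorem pderiv_zero_inclusion₄ (h : MvPolynomial (Fin 2) k) :
    MvPolynomial.pderiv 0 ((MvPolynomial.aeval (![X 2, X 3] : Fin 2 → MvPolynomial (Fin 4) k)) h) = 0 :=
  pderiv_aeval_eq_zero k _ 0 (fun i => by fin_cases i <;> simp [MvPolynomial.pderiv_X]) h

/-- `∂_y (ι h) = 0`. [folklore] -/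
theorem pderiv_one_inclusion₄ (h : MvPolynomial (Fin 2) k) :
    MvPolynomial.pderiv 1 ((MvPolynomial.aeval (![X 2, X 3] : Fin 2 → MvPolynomial (Fin 4) k)) h) = 0 :=
  pderiv_aeval_eq_zero k _ 1 (fun i => by fin_cases i <;> simp [MvPolynomial.pderiv_X]) h

/-- `σ (ι h) = ι′ h` for `σ : y ↦ x`. [folklore] -/
theorem sigma_inclusion₄ (h : MvPolynomial (Fin 2) k) :
    (MvPolynomial.aeval (![X 0, X 0, X 1, X 2] : Fin 4 → MvPolynomial (Fin 3) k))
        ((MvPolynomial.aeval (![X 2, X 3] : Fin 2 → MvPolynomial (Fin 4) k)) h) =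
      (MvPolynomial.aeval (![X 1, X 2] : Fin 2 → MvPolynomial (Fin 3) k)) h := by
  have hc : (MvPolynomial.aeval (![X 0, X 0, X 1, X 2] : Fin 4 → MvPolynomial (Fin 3) k)).comp
      (MvPolynomial.aeval (![X 2, X 3] : Fin 2 → MvPolynomial (Fin 4) k)) =
      MvPolynomial.aeval (![X 1, X 2] : Fin 2 → MvPolynomial (Fin 3) k) := by
    refine MvPolynomial.algHom_ext fun i => ?_
    fin_cases i <;> simp
  exact AlgHom.congr_fun hc h

/-- `ι″ (ι′ h) = ι h` for `ι″ : x, z, t ↦ X 0, X 2, X 3`. [folklore] -/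
theorem inclusion_inclusion₃ (h : MvPolynomial (Fin 2) k) :
    (MvPolynomial.aeval (![X 0, X 2, X 3] : Fin 3 → MvPolynomial (Fin 4) k))
        ((MvPolynomial.aeval (![X 1, X 2] : Fin 2 → MvPolynomial (Fin 3) k)) h) =
      (MvPolynomial.aeval (![X 2, X 3] : Fin 2 → MvPolynomial (Fin 4) k)) h := by
  have hc : (MvPolynomial.aeval (![X 0, X 2, X 3] : Fin 3 → MvPolynomial (Fin 4) k)).comp
      (MvPolynomial.aeval (![X 1, X 2] : Fin 2 → MvPolynomial (Fin 3) k)) =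
      MvPolynomial.aeval (![X 2, X 3] : Fin 2 → MvPolynomial (Fin 4) k) := by
    refine MvPolynomial.algHom_ext fun i => ?_
    fin_cases i <;> simp
  exact AlgHom.congr_fun hc h

/-- `σ f = F′`: `σ (xy − ι h) = x² − ι′ h`. [folklore] -/
theorem sigma_f_general (h : MvPolynomial (Fin 2) k) :
    (MvPolynomial.aeval (![X 0, X 0, X 1, X 2] : Fin 4 → MvPolynomial (Fin 3) k))
        (X 0 * X 1 - (MvPolynomial.aeval (![X 2, X 3] : Fin 2 → MvPolynomial (Fin 4) k)) h) =
      X 0 ^ 2 - (MvPolynomial.aeval (![X 1, X 2] : Fin 2 → MvPolynomial (Fin 3) k)) h := by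
  rw [map_sub, sigma_inclusion₄, map_mul]
  simp
  ring

/-- `ι″ F′ = f + x (x − y)`. [folklore] -/
theorem inclusion_F'_general (h : MvPolynomial (Fin 2) k) :
    (MvPolynomial.aeval (![X 0, X 2, X 3] : Fin 3 → MvPolynomial (Fin 4) k))
        (X 0 ^ 2 - (MvPolynomial.aeval (![X 1, X 2] : Fin 2 → MvPolynomial (Fin 3) k)) h) =
      (X 0 * X 1 - (MvPolynomial.aeval (![X 2, X 3] : Fin 2 → MvPolynomial (Fin 4) k)) h) + X 0 * (X 0 - X 1) := by
  rw [map_sub, inclusion_inclusion₃, map_pow]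
  simp
  ring

/-- `π′ F′ = −h`. [folklore] -/
theorem retraction_F' (h : MvPolynomial (Fin 2) k) :
    (MvPolynomial.aeval (![0, X 0, X 1] : Fin 3 → MvPolynomial (Fin 2) k))
        (X 0 ^ 2 - (MvPolynomial.aeval (![X 1, X 2] : Fin 2 → MvPolynomial (Fin 3) k)) h) = -h := by
  rw [map_sub, retraction_comp_inclusion₃, map_pow]
  simp

/-- `∂ₓ F′ = 2x`. [folklore] -/
theorem pderiv_zero_F' (h : MvPolynomial (Fin 2) k) :
    MvPolynomial.pderiv 0 (X 0 ^ 2 - (MvPolynomial.aeval (![X 1, X 2] : Fin 2 → MvPolynomial (Fin 3) k)) h) =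
      C 2 * X 0 := by
  rw [map_sub, pderiv_zero_inclusion₃, sub_zero]
  simp [Derivation.leibniz_pow, MvPolynomial.pderiv_X, map_ofNat]

/-- `∂_y f = x`. [folklore] -/
theorem pderiv_one_f_general (h : MvPolynomial (Fin 2) k) :
    MvPolynomial.pderiv 1 (X 0 * X 1 - (MvPolynomial.aeval (![X 2, X 3] : Fin 2 → MvPolynomial (Fin 4) k)) h) =
      X 0 := by
  rw [map_sub, pderiv_one_inclusion₄, sub_zero]
  simp [Derivation.leibniz, MvPolynomial.pderiv_X]

/-- `∂ₓ f = y`. [folklore] -/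
theorem pderiv_zero_f_general (h : MvPolynomial (Fin 2) k) :
    MvPolynomial.pderiv 0 (X 0 * X 1 - (MvPolynomial.aeval (![X 2, X 3] : Fin 2 → MvPolynomial (Fin 4) k)) h) =
      X 1 := by
  rw [map_sub, pderiv_zero_inclusion₄, sub_zero]
  simp [Derivation.leibniz, MvPolynomial.pderiv_X]

/-- `F′ = x² − ι′ h ≠ 0` when `2 ≠ 0` (its `x`-derivative is `2x ≠ 0`). [folklore] -/
theorem F'_general_ne_zero (h2 : (2 : k) ≠ 0) (h : MvPolynomial (Fin 2) k) :
    (X 0 ^ 2 - (MvPolynomial.aeval (![X 1, X 2] : Fin 2 → MvPolynomial (Fin 3) k)) h) ≠ 0 := by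
  intro h0
  have h1 := congrArg (MvPolynomial.pderiv 0) h0
  rw [pderiv_zero_F', map_zero, mul_eq_zero] at h1
  rcases h1 with h1 | h1
  · exact h2 (by simpa using congrArg (MvPolynomial.coeff 0) h1)
  · exact MvPolynomial.X_ne_zero 0 h1

/-- `f = xy − ι h ≠ 0` (its `y`-derivative is `x ≠ 0`). [folklore] -/
theorem f_general_ne_zero (h : MvPolynomial (Fin 2) k) :
    (X 0 * X 1 - (MvPolynomial.aeval (![X 2, X 3] : Fin 2 → MvPolynomial (Fin 4) k)) h) ≠ 0 := by
  intro h0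
  have h1 := congrArg (MvPolynomial.pderiv 1) h0
  rw [pderiv_one_f_general, map_zero] at h1
  exact MvPolynomial.X_ne_zero 0 h1

/-! ## §2 The middle stage `B_h = k[x,z,t]/(x² − h) ↠ C_h = k[z,t]/(h)` -/

/-- `x̄ ∈ B_h⁰` (`F′ ≡ −h ≠ 0 mod x`). [folklore] -/
theorem mk_X0_mem_nonZeroDivisors_general (h : MvPolynomial (Fin 2) k) (hh : h ≠ 0) :
    Ideal.Quotient.mk (Ideal.span ({X 0 ^ 2 - (MvPolynomial.aeval (![X 1, X 2] : Fin 2 → MvPolynomial (Fin 3) k)) h} :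
        Set (MvPolynomial (Fin 3) k))) (X 0) ∈
      (MvPolynomial (Fin 3) k ⧸ Ideal.span ({X 0 ^ 2 - (MvPolynomial.aeval (![X 1, X 2] :
        Fin 2 → MvPolynomial (Fin 3) k)) h} : Set (MvPolynomial (Fin 3) k)))⁰ := by
  refine mk_mem_nonZeroDivisors_of_ringHom
    (MvPolynomial.aeval (![0, X 0, X 1] : Fin 3 → MvPolynomial (Fin 2) k)).toRingHom
    (mem_nonZeroDivisors_of_ne_zero (MvPolynomial.X_ne_zero 0)) (by simp) (fun q hq => ?_) ?_
  · have hq' := sub_inclusion_retraction_mem₃ k q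
    rw [AlgHom.toRingHom_eq_coe, RingHom.coe_coe] at hq
    rw [hq, map_zero, sub_zero] at hq'
    exact Ideal.mem_span_singleton.mp hq'
  · rw [AlgHom.toRingHom_eq_coe, RingHom.coe_coe, retraction_F']
    exact mem_nonZeroDivisors_of_ne_zero (neg_ne_zero.mpr hh)

/-- `x̄ ∈ ca³(B_h)` when `2 ≠ 0` (`∂ₓ F′ = 2x`, KEPT-PROPER p522421). [folklore] -/
theorem mk_X0_mem_cohomologyAnnihilatorOfDegree_three_general (h2 : (2 : k) ≠ 0) (h : MvPolynomial (Fin 2) k) :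
    Ideal.Quotient.mk (Ideal.span ({X 0 ^ 2 - (MvPolynomial.aeval (![X 1, X 2] : Fin 2 → MvPolynomial (Fin 3) k)) h} :
        Set (MvPolynomial (Fin 3) k))) (X 0) ∈
      cohomologyAnnihilatorOfDegree (MvPolynomial (Fin 3) k ⧸ Ideal.span ({X 0 ^ 2 -
        (MvPolynomial.aeval (![X 1, X 2] : Fin 2 → MvPolynomial (Fin 3) k)) h} : Set (MvPolynomial (Fin 3) k))) 3 := by
  have hd : Ideal.Quotient.mk (Ideal.span ({X 0 ^ 2 - (MvPolynomial.aeval (![X 1, X 2] :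
        Fin 2 → MvPolynomial (Fin 3) k)) h} : Set (MvPolynomial (Fin 3) k)))
      (MvPolynomial.pderiv 0 (X 0 ^ 2 - (MvPolynomial.aeval (![X 1, X 2] : Fin 2 → MvPolynomial (Fin 3) k)) h)) ∈
      cohomologyAnnihilatorOfDegree (MvPolynomial (Fin 3) k ⧸ Ideal.span ({X 0 ^ 2 -
        (MvPolynomial.aeval (![X 1, X 2] : Fin 2 → MvPolynomial (Fin 3) k)) h} : Set (MvPolynomial (Fin 3) k))) 3 :=
    pderiv_mem_cohomologyAnnihilatorOfDegree (d := 2) _ (F'_general_ne_zero k h2 h) 0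
  rw [pderiv_zero_F'] at hd
  have hmem : Ideal.Quotient.mk (Ideal.span ({X 0 ^ 2 - (MvPolynomial.aeval (![X 1, X 2] :
        Fin 2 → MvPolynomial (Fin 3) k)) h} : Set (MvPolynomial (Fin 3) k))) (C (2⁻¹) * (C 2 * X 0)) ∈
      cohomologyAnnihilatorOfDegree (MvPolynomial (Fin 3) k ⧸ Ideal.span ({X 0 ^ 2 -
        (MvPolynomial.aeval (![X 1, X 2] : Fin 2 → MvPolynomial (Fin 3) k)) h} : Set (MvPolynomial (Fin 3) k))) 3 := by
    rw [map_mul]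
    exact Ideal.mul_mem_left _ _ hd
  have hX : (C (2⁻¹) * (C 2 * X 0) : MvPolynomial (Fin 3) k) = X 0 := by
    rw [← mul_assoc, ← C_mul, inv_mul_cancel₀ h2, C_1, one_mul]
  rwa [hX] at hmem

/-- **`B_h ↠ C_h`**: the retraction `π′ : x ↦ 0` induces a SURJECTIVE ring map `k[x,z,t]/(x² − h) → k[z,t]/(h)` with
kernel `(x̄)`, values `(π′ g)‾`. [OURS · L1 w44b] -/
theorem exists_ringHom_curveStage_general (h : MvPolynomial (Fin 2) k) :
    ∃ π : (MvPolynomial (Fin 3) k ⧸ Ideal.span ({X 0 ^ 2 - (MvPolynomial.aeval (![X 1, X 2] :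
        Fin 2 → MvPolynomial (Fin 3) k)) h} : Set (MvPolynomial (Fin 3) k))) →+*
        (MvPolynomial (Fin 2) k ⧸ Ideal.span ({h} : Set (MvPolynomial (Fin 2) k))),
      Function.Surjective π ∧ RingHom.ker π = Ideal.span {Ideal.Quotient.mk _ (X 0)} ∧
      ∀ g : MvPolynomial (Fin 3) k, π (Ideal.Quotient.mk _ g) =
        Ideal.Quotient.mk _ ((MvPolynomial.aeval (![0, X 0, X 1] : Fin 3 → MvPolynomial (Fin 2) k)) g) := by
  set π₀ : MvPolynomial (Fin 3) k →+* MvPolynomial (Fin 2) k ⧸ Ideal.span ({h} : Set (MvPolynomial (Fin 2) k)) :=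
    (Ideal.Quotient.mk _).comp (MvPolynomial.aeval (![0, X 0, X 1] : Fin 3 → MvPolynomial (Fin 2) k)).toRingHom
    with hπ₀
  have hπ₀_apply : ∀ g, π₀ g =
      Ideal.Quotient.mk _ ((MvPolynomial.aeval (![0, X 0, X 1] : Fin 3 → MvPolynomial (Fin 2) k)) g) := fun g => rfl
  have hπ₀F : ∀ a ∈ Ideal.span ({X 0 ^ 2 - (MvPolynomial.aeval (![X 1, X 2] : Fin 2 → MvPolynomial (Fin 3) k)) h} :
      Set (MvPolynomial (Fin 3) k)), π₀ a = 0 := by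
    intro a ha
    obtain ⟨v, rfl⟩ := Ideal.mem_span_singleton'.mp ha
    rw [map_mul, hπ₀_apply (X 0 ^ 2 - _), retraction_F', map_neg,
      Ideal.Quotient.eq_zero_iff_mem.mpr (Ideal.mem_span_singleton_self h), neg_zero, mul_zero]
  set π := Ideal.Quotient.lift _ π₀ hπ₀F with hπ
  have hπ_mk : ∀ g, π (Ideal.Quotient.mk _ g) = π₀ g := fun g => Ideal.Quotient.lift_mk _ _ _
  refine ⟨π, ?_, ?_, fun g => by rw [hπ_mk, hπ₀_apply]⟩
  · intro u
    obtain ⟨g, rfl⟩ := Ideal.Quotient.mk_surjective u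
    exact ⟨Ideal.Quotient.mk _ ((MvPolynomial.aeval (![X 1, X 2] : Fin 2 → MvPolynomial (Fin 3) k)) g),
      by rw [hπ_mk, hπ₀_apply, retraction_comp_inclusion₃]⟩
  · apply le_antisymm
    · intro u hu
      obtain ⟨g, rfl⟩ := Ideal.Quotient.mk_surjective u
      rw [RingHom.mem_ker, hπ_mk, hπ₀_apply, Ideal.Quotient.eq_zero_iff_mem, Ideal.mem_span_singleton'] at hu
      obtain ⟨r, hr⟩ := hu
      -- `g + ι′ r · F′ ∈ (x)`
      have hmem : g + (MvPolynomial.aeval (![X 1, X 2] : Fin 2 → MvPolynomial (Fin 3) k)) r *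
          (X 0 ^ 2 - (MvPolynomial.aeval (![X 1, X 2] : Fin 2 → MvPolynomial (Fin 3) k)) h) ∈
          Ideal.span ({X 0} : Set (MvPolynomial (Fin 3) k)) := by
        have h1 := sub_inclusion_retraction_mem₃ k g
        rw [← hr, map_mul] at h1
        have hid : g + (MvPolynomial.aeval (![X 1, X 2] : Fin 2 → MvPolynomial (Fin 3) k)) r *
            (X 0 ^ 2 - (MvPolynomial.aeval (![X 1, X 2] : Fin 2 → MvPolynomial (Fin 3) k)) h) =
            (g - (MvPolynomial.aeval (![X 1, X 2] : Fin 2 → MvPolynomial (Fin 3) k)) r *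
              (MvPolynomial.aeval (![X 1, X 2] : Fin 2 → MvPolynomial (Fin 3) k)) h) +
            (MvPolynomial.aeval (![X 1, X 2] : Fin 2 → MvPolynomial (Fin 3) k)) r * X 0 * X 0 := by
          ring
        rw [hid]
        exact Ideal.add_mem _ h1 (Ideal.mul_mem_left _ _ (Ideal.mem_span_singleton_self _))
      have heq : Ideal.Quotient.mk (Ideal.span ({X 0 ^ 2 - (MvPolynomial.aeval (![X 1, X 2] :
            Fin 2 → MvPolynomial (Fin 3) k)) h} : Set (MvPolynomial (Fin 3) k))) g =
          Ideal.Quotient.mk _ (g + (MvPolynomial.aeval (![X 1, X 2] : Fin 2 → MvPolynomial (Fin 3) k)) r *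
            (X 0 ^ 2 - (MvPolynomial.aeval (![X 1, X 2] : Fin 2 → MvPolynomial (Fin 3) k)) h)) := by
        rw [Ideal.Quotient.eq]
        have : g - (g + (MvPolynomial.aeval (![X 1, X 2] : Fin 2 → MvPolynomial (Fin 3) k)) r *
            (X 0 ^ 2 - (MvPolynomial.aeval (![X 1, X 2] : Fin 2 → MvPolynomial (Fin 3) k)) h)) =
            -(MvPolynomial.aeval (![X 1, X 2] : Fin 2 → MvPolynomial (Fin 3) k)) r *
              (X 0 ^ 2 - (MvPolynomial.aeval (![X 1, X 2] : Fin 2 → MvPolynomial (Fin 3) k)) h) := by ring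
        rw [this]
        exact Ideal.mul_mem_left _ _ (Ideal.mem_span_singleton_self _)
      have hmap : (Ideal.span ({X 0} : Set (MvPolynomial (Fin 3) k))).map
          (Ideal.Quotient.mk (Ideal.span ({X 0 ^ 2 - (MvPolynomial.aeval (![X 1, X 2] :
            Fin 2 → MvPolynomial (Fin 3) k)) h} : Set (MvPolynomial (Fin 3) k)))) =
          Ideal.span {Ideal.Quotient.mk (Ideal.span ({X 0 ^ 2 - (MvPolynomial.aeval (![X 1, X 2] :
            Fin 2 → MvPolynomial (Fin 3) k)) h} : Set (MvPolynomial (Fin 3) k))) (X 0)} := by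
        rw [Ideal.map_span, Set.image_singleton]
      rw [heq, ← hmap]
      exact Ideal.mem_map_of_mem _ hmem
    · rw [Ideal.span_le, Set.singleton_subset_iff, SetLike.mem_coe, RingHom.mem_ker, hπ_mk, hπ₀_apply]
      simp

/-- **Middle stage, general `h`**: `c̄ ∈ ca²(k[z,t]/(h)) ⇒ (ι′ c)‾ ∈ ca³(k[x,z,t]/(x² − h))` (`h ≠ 0`, `2 ≠ 0`).
[OURS · L1 w44b] -/
theorem mk_inclusion₃_mem_cohomologyAnnihilatorOfDegree_three (h2 : (2 : k) ≠ 0) (h : MvPolynomial (Fin 2) k)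
    (hh : h ≠ 0) (c : MvPolynomial (Fin 2) k)
    (hc : Ideal.Quotient.mk (Ideal.span ({h} : Set (MvPolynomial (Fin 2) k))) c ∈
      cohomologyAnnihilatorOfDegree (MvPolynomial (Fin 2) k ⧸ Ideal.span ({h} : Set (MvPolynomial (Fin 2) k))) 2) :
    Ideal.Quotient.mk (Ideal.span ({X 0 ^ 2 - (MvPolynomial.aeval (![X 1, X 2] : Fin 2 → MvPolynomial (Fin 3) k)) h} :
        Set (MvPolynomial (Fin 3) k))) ((MvPolynomial.aeval (![X 1, X 2] : Fin 2 → MvPolynomial (Fin 3) k)) c) ∈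
      cohomologyAnnihilatorOfDegree (MvPolynomial (Fin 3) k ⧸ Ideal.span ({X 0 ^ 2 -
        (MvPolynomial.aeval (![X 1, X 2] : Fin 2 → MvPolynomial (Fin 3) k)) h} : Set (MvPolynomial (Fin 3) k))) 3 := by
  obtain ⟨π, hsurj, hker, hπ⟩ := exists_ringHom_curveStage_general k h
  refine mem_cohomologyAnnihilatorOfDegree_of_surjective π hsurj hker (mk_X0_mem_nonZeroDivisors_general k h hh)
    (m := 1) (mk_X0_mem_cohomologyAnnihilatorOfDegree_three_general k h2 h) ?_
  rw [hπ, retraction_comp_inclusion₃]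
  exact hc

end Summit.ResolutionOfSingularities.ResolutionOfSingularities.Theorems.HomologicalConductor.ArenaLowerMiddle

end
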